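import Summits.NavierStokesRegularity.NavierStokesRegularity.Theses.SubcubicESS

/-!
# Birth skeleton — `QuinticSmoothing` (X₂ of the split of `SubcubicBound`, item
stmt-NavierStokesRegularity-18288, route SubcubicESS; concludes the route decl BY NAME)

Line `quiet-cylinder`: X₂ sits ON the energy line `b + (9/5)c = 3`, so every sub-line must be
exponent-loss-free.  A quiet FINAL TIME-EPOCH architecture is not (spacetime-uniform activity at
level `B` forces the quiet epoch length `~ t/(A B⁵)`, i.e. `γ = 5`); the quiet PARABOLIC CYLINDER
architecture is tight: uniform activity gives a quiet scale `√t/r ~ A^{1/5} B` (`β = 1/5`,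
`γ = 1`), and the sharp local `L⁵` ε-regularity `|u| ≤ K A / r` then lands exactly on the line at
`(b, c) = (6/5, 1)`.

* `stub_localQuinticRegularity` (known-type, CKN/ε-regularity at the `L⁵` endpoint with the global
  `L³` level controlling the far pressure; the threshold `ε/A` on the fifth power is what the
  `q = 6` perturbative bootstrap `Φ ≤ CA + C_q Φ^{2-5/q} δ^{5/q}` needs): a backward cylinder
  `[t-r², t] × B(x₀, r)` with `∫∫|u|⁵ ≤ ε/A` gives `|u(t, x₀)| ≤ K A / r`.
* `stub_quietCylinder` (OPEN, the heart: non-concentration of the `L⁵` activity at a point across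
  scales, with exponents `β + (9/5)γ ≤ 2`): every point has a quiet backward cylinder of radius
  `r ≥ √t / (C A^β (1+B)^γ)`.
* `QuinticSmoothing_of`: `(b, c) := (1 + β, γ)`, so `c > 0` and `b + (9/5)c ≤ 3`.
-/

namespace Summit.NavierStokesRegularity.NavierStokesRegularity.Cruxes.QuinticSmoothing.Lines.QuietCylinder

open MeasureTheory Set
open scoped ENNReal NNReal

/-- STUB (known-type): local `L⁵` ε-regularity at the final time with linear dependence on the
`L³` level. -/
theorem stub_localQuinticRegularity :
    ∃ ε K : ℝ, 0 < ε ∧ 0 ≤ K ∧ ∀ (T A r : ℝ) (u : ℝ → EuclideanSpace ℝ (Fin 3) → EuclideanSpace ℝ (Fin 3))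
      (p : ℝ → EuclideanSpace ℝ (Fin 3) → ℝ),
      (Literature.Analysis.FluidPDE.IsClassicalNSSolutionOn (Set.Icc 0 T) 1 0 u p ∧
        ∀ n : ℕ, ∃ C : NNReal, ∀ t ∈ Set.Icc 0 T,
          MeasureTheory.eLpNorm (iteratedFDeriv ℝ n (u t)) 2 MeasureTheory.volume ≤ C) →
      (∀ t ∈ Set.Icc 0 T, MeasureTheory.eLpNorm (u t) 3 MeasureTheory.volume ≤ ENNReal.ofReal A) →
      2 ≤ A → ∀ t ∈ Set.Ioc 0 T, ∀ x₀ : EuclideanSpace ℝ (Fin 3), 0 < r → r ^ 2 ≤ t / 2 →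
        (∫⁻ s in Set.Icc (t - r ^ 2) t, ∫⁻ x in Metric.ball x₀ r, ‖u s x‖ₑ ^ (5 : ℕ))
          ≤ ENNReal.ofReal (ε / A) →
        ‖u t x₀‖ ≤ K * A * r⁻¹ := by
  sorry

/-- STUB (open heart): every point has a polynomially large quiet backward cylinder, with
exponents inside the budget `β + (9/5) γ ≤ 2`. -/
theorem stub_quietCylinder :
    ∀ ε : ℝ, 0 < ε → ∃ C β γ : ℝ, 0 < C ∧ 0 < γ ∧ β + 9 / 5 * γ ≤ 2 ∧
      ∀ (T A B : ℝ) (u : ℝ → EuclideanSpace ℝ (Fin 3) → EuclideanSpace ℝ (Fin 3))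
        (p : ℝ → EuclideanSpace ℝ (Fin 3) → ℝ),
        (Literature.Analysis.FluidPDE.IsClassicalNSSolutionOn (Set.Icc 0 T) 1 0 u p ∧
          ∀ n : ℕ, ∃ C : NNReal, ∀ t ∈ Set.Icc 0 T,
            MeasureTheory.eLpNorm (iteratedFDeriv ℝ n (u t)) 2 MeasureTheory.volume ≤ C) →
        (∀ t ∈ Set.Icc 0 T, MeasureTheory.eLpNorm (u t) 3 MeasureTheory.volume ≤ ENNReal.ofReal A) →
        2 ≤ A → 0 ≤ B → ∀ t ∈ Set.Ioc 0 T,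
          (∫⁻ s in Set.Icc (t / 2) t, ∫⁻ x : EuclideanSpace ℝ (Fin 3), ‖u s x‖ₑ ^ (5 : ℕ))
            ≤ ENNReal.ofReal (B ^ 5) →
          ∀ x₀ : EuclideanSpace ℝ (Fin 3), ∃ r : ℝ, 0 < r ∧ r ^ 2 ≤ t / 2 ∧
            Real.sqrt t ≤ C * A ^ β * (1 + B) ^ γ * r ∧
            (∫⁻ s in Set.Icc (t - r ^ 2) t, ∫⁻ x in Metric.ball x₀ r, ‖u s x‖ₑ ^ (5 : ℕ))
              ≤ ENNReal.ofReal (ε / A) := by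
  sorry

/-- COMPOSITION (kernel-checked): `(b, c) := (1 + β, γ)` lands on or inside the energy line. -/
theorem QuinticSmoothing_of
    (h₁ : ∃ ε K : ℝ, 0 < ε ∧ 0 ≤ K ∧ ∀ (T A r : ℝ) (u : ℝ → EuclideanSpace ℝ (Fin 3) → EuclideanSpace ℝ (Fin 3))
      (p : ℝ → EuclideanSpace ℝ (Fin 3) → ℝ),
      (Literature.Analysis.FluidPDE.IsClassicalNSSolutionOn (Set.Icc 0 T) 1 0 u p ∧
        ∀ n : ℕ, ∃ C : NNReal, ∀ t ∈ Set.Icc 0 T,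
          MeasureTheory.eLpNorm (iteratedFDeriv ℝ n (u t)) 2 MeasureTheory.volume ≤ C) →
      (∀ t ∈ Set.Icc 0 T, MeasureTheory.eLpNorm (u t) 3 MeasureTheory.volume ≤ ENNReal.ofReal A) →
      2 ≤ A → ∀ t ∈ Set.Ioc 0 T, ∀ x₀ : EuclideanSpace ℝ (Fin 3), 0 < r → r ^ 2 ≤ t / 2 →
        (∫⁻ s in Set.Icc (t - r ^ 2) t, ∫⁻ x in Metric.ball x₀ r, ‖u s x‖ₑ ^ (5 : ℕ))
          ≤ ENNReal.ofReal (ε / A) →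
        ‖u t x₀‖ ≤ K * A * r⁻¹)
    (h₂ : ∀ ε : ℝ, 0 < ε → ∃ C β γ : ℝ, 0 < C ∧ 0 < γ ∧ β + 9 / 5 * γ ≤ 2 ∧
      ∀ (T A B : ℝ) (u : ℝ → EuclideanSpace ℝ (Fin 3) → EuclideanSpace ℝ (Fin 3))
        (p : ℝ → EuclideanSpace ℝ (Fin 3) → ℝ),
        (Literature.Analysis.FluidPDE.IsClassicalNSSolutionOn (Set.Icc 0 T) 1 0 u p ∧
          ∀ n : ℕ, ∃ C : NNReal, ∀ t ∈ Set.Icc 0 T,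
            MeasureTheory.eLpNorm (iteratedFDeriv ℝ n (u t)) 2 MeasureTheory.volume ≤ C) →
        (∀ t ∈ Set.Icc 0 T, MeasureTheory.eLpNorm (u t) 3 MeasureTheory.volume ≤ ENNReal.ofReal A) →
        2 ≤ A → 0 ≤ B → ∀ t ∈ Set.Ioc 0 T,
          (∫⁻ s in Set.Icc (t / 2) t, ∫⁻ x : EuclideanSpace ℝ (Fin 3), ‖u s x‖ₑ ^ (5 : ℕ))
            ≤ ENNReal.ofReal (B ^ 5) →
          ∀ x₀ : EuclideanSpace ℝ (Fin 3), ∃ r : ℝ, 0 < r ∧ r ^ 2 ≤ t / 2 ∧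
            Real.sqrt t ≤ C * A ^ β * (1 + B) ^ γ * r ∧
            (∫⁻ s in Set.Icc (t - r ^ 2) t, ∫⁻ x in Metric.ball x₀ r, ‖u s x‖ₑ ^ (5 : ℕ))
              ≤ ENNReal.ofReal (ε / A)) :
    Summit.NavierStokesRegularity.NavierStokesRegularity.Theses.SubcubicESS.QuinticSmoothing := by
  obtain ⟨ε, K, hε, hK, h₁⟩ := h₁
  obtain ⟨C, β, γ, hC, hγ, hbud, h₂⟩ := h₂ ε hε
  refine ⟨K * C, 1 + β, γ, hγ, by linarith, ?_⟩
  intro T A B u p hcl hL3 hA hB t ht hq x₀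
  have hA0 : 0 < A := by linarith
  have ht0 : 0 < t := ht.1
  obtain ⟨r, hr, hrt, hsq, hquiet⟩ := h₂ T A B u p hcl hL3 hA hB t ht hq x₀
  have hloc := h₁ T A r u p hcl hL3 hA t ht x₀ hr hrt hquiet
  -- r⁻¹ ≤ C A^β (1+B)^γ / √t
  set X : ℝ := C * A ^ β * (1 + B) ^ γ with hXdef
  have hX0 : 0 < X := by positivity
  have hst : 0 < Real.sqrt t := Real.sqrt_pos.2 ht0
  have hrinv : r⁻¹ ≤ X * (Real.sqrt t)⁻¹ := by
    rw [inv_le_iff_one_le_mul₀ hr]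
    calc (1 : ℝ) = Real.sqrt t * (Real.sqrt t)⁻¹ := (mul_inv_cancel₀ hst.ne').symm
      _ ≤ (X * r) * (Real.sqrt t)⁻¹ := by gcongr
      _ = X * (Real.sqrt t)⁻¹ * r := by ring
  have hsqrt : (Real.sqrt t)⁻¹ = t ^ (-(1 / 2 : ℝ)) := by
    rw [Real.sqrt_eq_rpow, ← Real.rpow_neg_one, ← Real.rpow_mul ht0.le]
    norm_num
  have hAβ : A * A ^ β = A ^ (1 + β) := by
    rw [Real.rpow_add hA0, Real.rpow_one]
  calc ‖u t x₀‖ ≤ K * A * r⁻¹ := hloc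
    _ ≤ K * A * (X * (Real.sqrt t)⁻¹) := by gcongr
    _ = K * C * (A * A ^ β) * (1 + B) ^ γ * (Real.sqrt t)⁻¹ := by simp only [hXdef]; ring
    _ = K * C * A ^ (1 + β) * (1 + B) ^ γ * t ^ (-(1 / 2 : ℝ)) := by rw [hAβ, hsqrt]

/-- Type-check that the registered stubs feed the composition verbatim (the piece, modulo the two stubs). -/
theorem QuinticSmoothing_of_stubs :
    Summit.NavierStokesRegularity.NavierStokesRegularity.Theses.SubcubicESS.QuinticSmoothing :=
  QuinticSmoothing_of stub_localQuinticRegularity stub_quietCylinder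

end Summit.NavierStokesRegularity.NavierStokesRegularity.Cruxes.QuinticSmoothing.Lines.QuietCylinder
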